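import Literature.Probability.LatticeModels.ScaleFrameTwoGraphsJunk
import Literature.Probability.LatticeModels.ScaleFrameTwoGraphsTools
import Literature.Probability.LatticeModels.BlockExplorationTopOff
import HarnessLib

/-!
# The top-level decomposition of a connection probability over the window data of a scale frame
(proved)

Topic `Literature/Probability/LatticeModels` (trunk `StatMech`, family `crit-ising`). One graph of
the two-graph comparison of Kesten's ratio-limit scheme (H. Kesten, PTRF 73 (1986), proof of Thm. 3) in
the planarity-free form of Basu–Sapozhnikov (ECP 22 (2017), §2): a finite graph `G` carrying a scale
frame `F` (`F.E = E(G)`), a window `ι : Wt ↪ V` whose core `W₀` contains every good vertex of radius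
`< a_K M^m + 2η` (`a_K = aM^K`) and has no neighbour off the window, an anchor `ι z` inside
`inSet a_K` and a far target `y` (radius `≥ a_K M^m + η` if good). Then (`openConn_eq_windowSum_add_junk`)

  `P_G[ι z ↔ y] = Σ_{d = (U, R) window datum} t(d) · u_z(d) + e`,  `0 ≤ e ≤ (1-c)^{m/2} P_G[ι z ↔ y]`,

where, for the exploration of the block `annSet a_K (a_K M^m)` from `inSet a_K` with the rim wired off
the inside, `t(d) = P_G[F(ι d) ∩ OutP(ι d)]` and `u_z(d) = P_G[F(ι d) ∩ InP_z(ι d)] / P_G[F(ι d)]`: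
the top-level identity `openConn_eq_sum_add_notWiredOff` over the data of `G`, the junk bound
`ScaleFrame.real_inter_notWiredOff_le`, and the observation that data not carried by the window have
null datum events (`sum_data_eq_sum_window`: the explored set lies in `inSet ∪ annSet ⊆ ι W₀` and the
rim consists of neighbours of explored vertices).

Everything is proved; no definitions, no named facts.

## References

* [Kesten1986] H. Kesten, *Probab. Theory Related Fields* 73 (1986) 369–394, proof of Thm. 3,
  eqs. (15)–(17) and the estimate (8).
* [BasuSapozhnikov2017ECP] D. Basu, A. Sapozhnikov, ECP 22 (2017) no. 26, §2, eq. (2.4).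
-/

open MeasureTheory Finset SimpleGraph
open Literature.Probability.Percolation (BondConfig openConn openConnIn explSet explRim explEvent)

namespace Literature.Probability.LatticeModels

/-! ### Data off the window carry no mass -/

section Reindex

variable {V Wt : Type*} [Fintype V] [DecidableEq V] [Fintype Wt]
  (G : SimpleGraph V) [DecidableRel G.Adj] (ι : Wt ↪ V) (W₀ : Set Wt)

/-- **Reindexing the exploration data by the window.** If `In ∪ Blk` lies in the image of the core
`W₀` of the window and no vertex of `ι W₀` has a neighbour off the window, then every datum `(U, R)`
of the exploration of `Blk` from `In` whose datum event (read on `ω ∩ E(G)`) is non-null is the image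
of a window datum (`U = 𝒞 ⊆ In ∪ Blk`, and the rim consists of `G`-neighbours of explored vertices);
hence a sum over the data of `G` of quantities vanishing on null datum events is the sum over the
window data. [cite: BasuSapozhnikov2017ECP, §2 eq. (2.4)] -/
theorem sum_data_eq_sum_window {p q : ℝ} (hp : p ∈ Set.Icc (0 : ℝ) 1) (hq : 0 < q) {In Blk : Set V}
    (hIB : In ∪ Blk ⊆ ι '' W₀) (hnb : ∀ w ∈ W₀, ∀ v : V, G.Adj (ι w) v → ∃ b : Wt, v = ι b)
    (f : Set V → Set V → ℝ)
    (hf : ∀ U R : Set V, (rcMeasure G p q ∅).real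
      {ω | ω ∩ (↑G.edgeFinset : Set (Sym2 V)) ∈ explEvent In Blk U R} = 0 → f U R = 0) :
    ∑ d : Finset V × Finset V, f ↑d.1 ↑d.2 = ∑ d : Finset Wt × Finset Wt, f (ι '' ↑d.1) (ι '' ↑d.2) := by
  classical
  haveI := isProbabilityMeasure_rcMeasure G hp hq ∅
  set emb : Finset Wt × Finset Wt ↪ Finset V × Finset V :=
    ⟨fun d => (d.1.map ι, d.2.map ι), fun d d' h => Prod.ext (Finset.map_injective ι (Prod.ext_iff.1 h).1)
      (Finset.map_injective ι (Prod.ext_iff.1 h).2)⟩ with hemb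
  have h1 : ∑ d : Finset Wt × Finset Wt, f (ι '' ↑d.1) (ι '' ↑d.2) =
      ∑ d ∈ (Finset.univ : Finset (Finset Wt × Finset Wt)).map emb, f ↑d.1 ↑d.2 := by
    rw [Finset.sum_map]
    refine Finset.sum_congr rfl fun d _ => ?_
    simp only [hemb, Function.Embedding.coeFn_mk, Finset.coe_map]
  rw [h1]
  symm
  refine Finset.sum_subset (Finset.subset_univ _) fun d _ hd => hf _ _ ?_
  -- a datum off the image of the window has a null datum event
  by_contra hne
  obtain ⟨ω, -, hω⟩ := exists_mem_of_rcMeasure_real_pos G hp hq ∅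
    (lt_of_le_of_ne measureReal_nonneg (Ne.symm hne))
  obtain ⟨hU, hR⟩ := Percolation.mem_explEvent_iff.1 hω
  have hUr : ∀ v ∈ d.1, v ∈ Set.range ι := fun v hv => by
    have hv' : v ∈ explSet In Blk ((↑ω : BondConfig V) ∩ ↑G.edgeFinset) := hU ▸ Finset.mem_coe.2 hv
    obtain ⟨w, -, rfl⟩ := hIB (Percolation.explSet_subset In Blk _ hv')
    exact ⟨w, rfl⟩
  have hRr : ∀ r ∈ d.2, r ∈ Set.range ι := fun r hr => by
    have hr' : r ∈ explRim In Blk ((↑ω : BondConfig V) ∩ ↑G.edgeFinset) := hR ▸ Finset.mem_coe.2 hr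
    obtain ⟨-, v, hv, hvr⟩ := Percolation.mem_explRim_iff.1 hr'
    obtain ⟨w, hw, rfl⟩ := hIB (Percolation.explSet_subset In Blk _ hv)
    obtain ⟨b, rfl⟩ := hnb w hw r ((mem_edgeSet (G := G)).1 (mem_edgeFinset.1 hvr.2))
    exact ⟨b, rfl⟩
  obtain ⟨t₁, ht₁⟩ := exists_map_eq_of_forall_mem_range ι d.1 hUr
  obtain ⟨t₂, ht₂⟩ := exists_map_eq_of_forall_mem_range ι d.2 hRr
  refine hd (Finset.mem_map.2 ⟨(t₁, t₂), Finset.mem_univ _, ?_⟩)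
  simp only [hemb, Function.Embedding.coeFn_mk, ht₁, ht₂]

end Reindex

/-! ### One graph: the top-level decomposition over the window data, with small junk -/

namespace ScaleFrame

variable {V Wt : Type*} [Fintype V] [DecidableEq V] [Fintype Wt] (F : ScaleFrame V)

/-- Scale bookkeeping of the level-`K` block: `a ≤ a_K`, `η ≤ a_K`, `a_K + η ≤ a_K M^m = aM^{K+m} ≤ Rmax` for
`m ≥ 1`, `M ≥ 4`, `η ≤ a`, `aM^{K+m+1} ≤ Rmax`. [folklore] -/
theorem level_scales {a M : ℝ} {K m : ℕ} (ha : 0 < a) (hM : 4 ≤ M) (hm : 1 ≤ m) (hη : F.η ≤ a)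
    (hR : a * M ^ (K + m + 1) ≤ F.Rmax) :
    0 < a * M ^ K ∧ a ≤ a * M ^ K ∧ F.η ≤ a * M ^ K ∧ a * M ^ K + F.η ≤ a * M ^ K * M ^ m ∧
      a * M ^ K * M ^ m = a * M ^ (K + m) ∧ a * M ^ (K + m) ≤ F.Rmax := by
  have hM1 : (1 : ℝ) ≤ M := by linarith
  have haK : 0 < a * M ^ K := mul_pos ha (pow_pos (by linarith) K)
  have haaK : a ≤ a * M ^ K := le_mul_of_one_le_right ha.le (one_le_pow₀ hM1)
  have hMm : (4 : ℝ) ≤ M ^ m := by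
    calc (4 : ℝ) ≤ M := hM
      _ = M ^ 1 := (pow_one M).symm
      _ ≤ M ^ m := pow_le_pow_right₀ hM1 hm
  have h3 : a * M ^ K * 4 ≤ a * M ^ K * M ^ m := mul_le_mul_of_nonneg_left hMm haK.le
  refine ⟨haK, haaK, hη.trans haaK, by linarith, by rw [pow_add, mul_assoc], ?_⟩
  exact (scale_mono ha hM (Nat.le_succ _)).trans hR

/-- **The top-level decomposition of a connection probability over the window data** (Kesten 1986,
proof of Thm. 3, eqs. (15)–(17) with the estimate (8); Basu–Sapozhnikov 2017, §2 eq. (2.4)). See the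
module docstring: for the free random-cluster measure `P` of `G` (`0 < p < 1`, `q ≥ 1`) and the
exploration of `annSet a_K (a_K M^m)` from `inSet a_K` with the rim wired off the inside,
`P[ι z ↔ y] = Σ_d t(d) u_z(d) + e` over the WINDOW data `d`, with `0 ≤ e ≤ (1-c)^{m/2} P[ι z ↔ y]`,
where `t`, `u` are any functions agreeing with `P[F(ι d) ∩ OutP(ι d)]` and
`P[F(ι d) ∩ InP_z(ι d)] / P[F(ι d)]`. [cite: Kesten1986, proof of Thm. 3] -/
theorem openConn_eq_windowSum_add_junk (G : SimpleGraph V) [DecidableRel G.Adj] (ι : Wt ↪ V)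
    (W₀ : Set Wt) {p q c a M : ℝ} {m : ℕ} (K : ℕ) (z : Wt) (y : V)
    (hp : p ∈ Set.Ioo (0 : ℝ) 1) (hq : 1 ≤ q) (hc1 : c ≤ 1) (ha : 0 < a) (hM : 4 ≤ M) (hm : 1 ≤ m)
    (hη : F.η ≤ a) (hE : F.E = G.edgeFinset) (hR : a * M ^ (K + m + 1) ≤ F.Rmax)
    (hL : F.LadderRSWb p q c a M (K + m + 1) 13)
    (hnb : ∀ w ∈ W₀, ∀ v : V, G.Adj (ι w) v → ∃ b : Wt, v = ι b)
    (hcore : ∀ v : V, v ∈ F.good → F.rad v < a * M ^ K * M ^ m + 2 * F.η → ∃ w ∈ W₀, v = ι w)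
    (hz : ι z ∈ F.inSet (a * M ^ K)) (hy : y ∈ F.good → a * M ^ K * M ^ m + F.η ≤ F.rad y)
    (t u : Finset Wt × Finset Wt → ℝ)
    (ht : ∀ d : Finset Wt × Finset Wt, t d = (rcMeasure G p q ∅).real
      ({ω | ω ∩ (↑G.edgeFinset : Set (Sym2 V)) ∈
          explEvent (F.inSet (a * M ^ K)) (F.annSet (a * M ^ K) (a * M ^ K * M ^ m))
            (ι '' ↑d.1) (ι '' ↑d.2) ∩
          {ω | ∀ r ∈ ι '' ↑d.2, ∀ r₂ ∈ ι '' ↑d.2, ∃ v ∈ ι '' ↑d.1 \ F.inSet (a * M ^ K),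
            ∃ v' ∈ ι '' ↑d.1 \ F.inSet (a * M ^ K), s(v, r) ∈ ω ∧ s(v', r₂) ∈ ω ∧
              ω ∈ openConnIn (ι '' ↑d.1 \ F.inSet (a * M ^ K)) v v'}} ∩
        {ω | ∃ w ∈ ι '' ↑d.2, ω ∩ (↑G.edgeFinset : Set (Sym2 V)) ∈ openConnIn (ι '' ↑d.1)ᶜ w y}))
    (hu : ∀ d : Finset Wt × Finset Wt, u d = (rcMeasure G p q ∅).real
      ({ω | ω ∩ (↑G.edgeFinset : Set (Sym2 V)) ∈
          explEvent (F.inSet (a * M ^ K)) (F.annSet (a * M ^ K) (a * M ^ K * M ^ m))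
            (ι '' ↑d.1) (ι '' ↑d.2) ∩
          {ω | ∀ r ∈ ι '' ↑d.2, ∀ r₂ ∈ ι '' ↑d.2, ∃ v ∈ ι '' ↑d.1 \ F.inSet (a * M ^ K),
            ∃ v' ∈ ι '' ↑d.1 \ F.inSet (a * M ^ K), s(v, r) ∈ ω ∧ s(v', r₂) ∈ ω ∧
              ω ∈ openConnIn (ι '' ↑d.1 \ F.inSet (a * M ^ K)) v v'}} ∩
        {ω | ∃ w ∈ ι '' ↑d.2, ∃ v ∈ ι '' ↑d.1,
          ω ∩ (↑G.edgeFinset : Set (Sym2 V)) ∈ openConnIn (ι '' ↑d.1) (ι z) v ∧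
            s(v, w) ∈ ω ∩ (↑G.edgeFinset : Set (Sym2 V))}) /
      (rcMeasure G p q ∅).real
        {ω | ω ∩ (↑G.edgeFinset : Set (Sym2 V)) ∈
          explEvent (F.inSet (a * M ^ K)) (F.annSet (a * M ^ K) (a * M ^ K * M ^ m))
            (ι '' ↑d.1) (ι '' ↑d.2) ∩
          {ω | ∀ r ∈ ι '' ↑d.2, ∀ r₂ ∈ ι '' ↑d.2, ∃ v ∈ ι '' ↑d.1 \ F.inSet (a * M ^ K),
            ∃ v' ∈ ι '' ↑d.1 \ F.inSet (a * M ^ K), s(v, r) ∈ ω ∧ s(v', r₂) ∈ ω ∧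
              ω ∈ openConnIn (ι '' ↑d.1 \ F.inSet (a * M ^ K)) v v'}}) :
    ∃ e : ℝ, 0 ≤ e ∧ e ≤ (1 - c) ^ (m / 2) * (rcMeasure G p q ∅).real (openConn (ι z) y) ∧
      (rcMeasure G p q ∅).real (openConn (ι z) y) = ∑ d : Finset Wt × Finset Wt, t d * u d + e := by
  classical
  have hp' : p ∈ Set.Icc (0 : ℝ) 1 := ⟨hp.1.le, hp.2.le⟩
  have hq0 : 0 < q := one_pos.trans_le hq
  haveI := isProbabilityMeasure_rcMeasure G hp' hq0 ∅
  obtain ⟨haK0, -, hηK, hTop, hKm, hKmR⟩ := F.level_scales ha hM hm hη hR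
  have hTopR : a * M ^ K * M ^ m ≤ F.Rmax := hKm ▸ hKmR
  -- the hypotheses of the top-level identity
  have hyIn : y ∉ F.inSet (a * M ^ K) := fun h => by
    have h1 := hy h.1
    have h2 := h.2
    linarith [F.η_pos]
  have hyBlk : y ∉ F.annSet (a * M ^ K) (a * M ^ K * M ^ m) := fun h => by
    have h1 := hy h.1
    have h2 := h.2.2
    linarith [F.η_pos]
  have hvg : ∀ v ∈ F.inSet (a * M ^ K) ∪ F.annSet (a * M ^ K) (a * M ^ K * M ^ m),
      v ∈ F.good ∧ F.rad v < a * M ^ K * M ^ m := fun v hv =>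
    hv.elim (fun h => ⟨h.1, by linarith [h.2, F.η_pos]⟩) fun h => ⟨h.1, h.2.2⟩
  have hyadj : ∀ v ∈ F.inSet (a * M ^ K) ∪ F.annSet (a * M ^ K) (a * M ^ K * M ^ m),
      ¬ G.Adj v y := by
    intro v hv hvy
    have he : s(v, y) ∈ F.E := by rw [hE, mem_edgeFinset]; exact hvy
    obtain ⟨hyg, hyr⟩ := F.adj_good _ he v (Sym2.mem_mk_left v y) y (Sym2.mem_mk_right v y)
      (hvg v hv).1 ((hvg v hv).2.trans_le hTopR)
    have h1 := hy hyg
    have h2 := (abs_lt.1 hyr).2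
    linarith [(hvg v hv).2]
  have hInadj := F.adj_inSet_subset G hE hTop hTopR
  -- the top-level identity over the data of `G`
  have hTOP := openConn_eq_sum_add_notWiredOff G hp' hq0 (F.inSet (a * M ^ K))
    (F.annSet (a * M ^ K) (a * M ^ K * M ^ m)) (ι z) y hz hyIn hyBlk hyadj hInadj
  dsimp only at hTOP
  -- `{ω | ω ∩ E(G) ∈ {ι z ↔ y}}` versus `{ι z ↔ y}`
  have hbr : (rcMeasure G p q ∅).real
      {ω : BondConfig V | ω ∩ (↑G.edgeFinset : Set (Sym2 V)) ∈ openConn (ι z) y} =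
      (rcMeasure G p q ∅).real (openConn (ι z) y) :=
    measureReal_congr (rcMeasure_ae_eq_of_forall_subset_edgeSet G hp' hq0 ∅ fun ω hω => by
      rw [Set.mem_setOf_eq, coe_edgeFinset, Set.inter_eq_left.2 hω])
  -- the junk
  have hA : IsUpperSet {ω : BondConfig V | ω ∩ (↑G.edgeFinset : Set (Sym2 V)) ∈ openConn (ι z) y} :=
    fun ω₁ ω₂ h h₁ => Percolation.isUpperSet_openConn _ _ (Set.inter_subset_inter_left _ h) h₁
  have hJ := F.real_inter_notWiredOff_le G K hp' hq hc1 ha hM hη hE hKmR (Nat.le_succ _)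
    (by norm_num : 1 ≤ 13) hL hA
  rw [hbr] at hJ
  refine ⟨_, measureReal_nonneg, hJ, ?_⟩
  rw [← hbr, hTOP, add_left_inj]
  -- the data off the window carry no mass
  have hIB : F.inSet (a * M ^ K) ∪ F.annSet (a * M ^ K) (a * M ^ K * M ^ m) ⊆ ι '' W₀ := by
    intro v hv
    obtain ⟨w, hw, rfl⟩ := hcore v (hvg v hv).1 (by linarith [(hvg v hv).2, F.η_pos])
    exact ⟨w, hw, rfl⟩
  rw [sum_data_eq_sum_window G ι W₀ hp' hq0 hIB hnb (fun U R =>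
    (rcMeasure G p q ∅).real
      ({ω | ω ∩ (↑G.edgeFinset : Set (Sym2 V)) ∈
          explEvent (F.inSet (a * M ^ K)) (F.annSet (a * M ^ K) (a * M ^ K * M ^ m)) U R ∩
          {ω | ∀ r ∈ R, ∀ r₂ ∈ R, ∃ v ∈ U \ F.inSet (a * M ^ K), ∃ v' ∈ U \ F.inSet (a * M ^ K),
            s(v, r) ∈ ω ∧ s(v', r₂) ∈ ω ∧ ω ∈ openConnIn (U \ F.inSet (a * M ^ K)) v v'}} ∩
        {ω | ∃ w ∈ R, ω ∩ (↑G.edgeFinset : Set (Sym2 V)) ∈ openConnIn Uᶜ w y}) *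
    ((rcMeasure G p q ∅).real
      ({ω | ω ∩ (↑G.edgeFinset : Set (Sym2 V)) ∈
          explEvent (F.inSet (a * M ^ K)) (F.annSet (a * M ^ K) (a * M ^ K * M ^ m)) U R ∩
          {ω | ∀ r ∈ R, ∀ r₂ ∈ R, ∃ v ∈ U \ F.inSet (a * M ^ K), ∃ v' ∈ U \ F.inSet (a * M ^ K),
            s(v, r) ∈ ω ∧ s(v', r₂) ∈ ω ∧ ω ∈ openConnIn (U \ F.inSet (a * M ^ K)) v v'}} ∩
        {ω | ∃ w ∈ R, ∃ v ∈ U, ω ∩ (↑G.edgeFinset : Set (Sym2 V)) ∈ openConnIn U (ι z) v ∧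
          s(v, w) ∈ ω ∩ (↑G.edgeFinset : Set (Sym2 V))}) /
     (rcMeasure G p q ∅).real
      {ω | ω ∩ (↑G.edgeFinset : Set (Sym2 V)) ∈
          explEvent (F.inSet (a * M ^ K)) (F.annSet (a * M ^ K) (a * M ^ K * M ^ m)) U R ∩
          {ω | ∀ r ∈ R, ∀ r₂ ∈ R, ∃ v ∈ U \ F.inSet (a * M ^ K), ∃ v' ∈ U \ F.inSet (a * M ^ K),
            s(v, r) ∈ ω ∧ s(v', r₂) ∈ ω ∧ ω ∈ openConnIn (U \ F.inSet (a * M ^ K)) v v'}})) ?_]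
  · exact Finset.sum_congr rfl fun d _ => by rw [ht d, hu d]
  · -- the summand vanishes on a null datum event
    intro U R h0
    rw [measureReal_mono_null (Set.inter_subset_left.trans fun ω hω => hω.1) h0, zero_mul]

/-- **The top-level decomposition over the window data, packaged**: the weights `t(d) = P[F(ι d) ∩ OutP(ι d)]`,
the conditional inside probabilities `u_z(d) = P[F(ι d) ∩ InP_z(ι d)] / P[F(ι d)]` and the junk `e` of
`openConn_eq_windowSum_add_junk`, as functions with their defining equations.
[cite: Kesten1986, proof of Thm. 3] -/
theorem exists_windowSum_add_junk (G : SimpleGraph V) [DecidableRel G.Adj] (ι : Wt ↪ V)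
    (W₀ : Set Wt) {p q c a M : ℝ} {m : ℕ} (K : ℕ) (z : Wt) (y : V)
    (hp : p ∈ Set.Ioo (0 : ℝ) 1) (hq : 1 ≤ q) (hc1 : c ≤ 1) (ha : 0 < a) (hM : 4 ≤ M) (hm : 1 ≤ m)
    (hη : F.η ≤ a) (hE : F.E = G.edgeFinset) (hR : a * M ^ (K + m + 1) ≤ F.Rmax)
    (hL : F.LadderRSWb p q c a M (K + m + 1) 13)
    (hnb : ∀ w ∈ W₀, ∀ v : V, G.Adj (ι w) v → ∃ b : Wt, v = ι b)
    (hcore : ∀ v : V, v ∈ F.good → F.rad v < a * M ^ K * M ^ m + 2 * F.η → ∃ w ∈ W₀, v = ι w)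
    (hz : ι z ∈ F.inSet (a * M ^ K)) (hy : y ∈ F.good → a * M ^ K * M ^ m + F.η ≤ F.rad y) :
    ∃ (t u : Finset Wt × Finset Wt → ℝ) (e : ℝ),
      (∀ d : Finset Wt × Finset Wt, t d = (rcMeasure G p q ∅).real
        ({ω | ω ∩ (↑G.edgeFinset : Set (Sym2 V)) ∈
            explEvent (F.inSet (a * M ^ K)) (F.annSet (a * M ^ K) (a * M ^ K * M ^ m))
              (ι '' ↑d.1) (ι '' ↑d.2) ∩
            {ω | ∀ r ∈ ι '' ↑d.2, ∀ r₂ ∈ ι '' ↑d.2, ∃ v ∈ ι '' ↑d.1 \ F.inSet (a * M ^ K),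
              ∃ v' ∈ ι '' ↑d.1 \ F.inSet (a * M ^ K), s(v, r) ∈ ω ∧ s(v', r₂) ∈ ω ∧
                ω ∈ openConnIn (ι '' ↑d.1 \ F.inSet (a * M ^ K)) v v'}} ∩
          {ω | ∃ w ∈ ι '' ↑d.2, ω ∩ (↑G.edgeFinset : Set (Sym2 V)) ∈ openConnIn (ι '' ↑d.1)ᶜ w y})) ∧
      (∀ d : Finset Wt × Finset Wt, u d = (rcMeasure G p q ∅).real
        ({ω | ω ∩ (↑G.edgeFinset : Set (Sym2 V)) ∈
            explEvent (F.inSet (a * M ^ K)) (F.annSet (a * M ^ K) (a * M ^ K * M ^ m))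
              (ι '' ↑d.1) (ι '' ↑d.2) ∩
            {ω | ∀ r ∈ ι '' ↑d.2, ∀ r₂ ∈ ι '' ↑d.2, ∃ v ∈ ι '' ↑d.1 \ F.inSet (a * M ^ K),
              ∃ v' ∈ ι '' ↑d.1 \ F.inSet (a * M ^ K), s(v, r) ∈ ω ∧ s(v', r₂) ∈ ω ∧
                ω ∈ openConnIn (ι '' ↑d.1 \ F.inSet (a * M ^ K)) v v'}} ∩
          {ω | ∃ w ∈ ι '' ↑d.2, ∃ v ∈ ι '' ↑d.1,
            ω ∩ (↑G.edgeFinset : Set (Sym2 V)) ∈ openConnIn (ι '' ↑d.1) (ι z) v ∧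
              s(v, w) ∈ ω ∩ (↑G.edgeFinset : Set (Sym2 V))}) /
        (rcMeasure G p q ∅).real
          {ω | ω ∩ (↑G.edgeFinset : Set (Sym2 V)) ∈
            explEvent (F.inSet (a * M ^ K)) (F.annSet (a * M ^ K) (a * M ^ K * M ^ m))
              (ι '' ↑d.1) (ι '' ↑d.2) ∩
            {ω | ∀ r ∈ ι '' ↑d.2, ∀ r₂ ∈ ι '' ↑d.2, ∃ v ∈ ι '' ↑d.1 \ F.inSet (a * M ^ K),
              ∃ v' ∈ ι '' ↑d.1 \ F.inSet (a * M ^ K), s(v, r) ∈ ω ∧ s(v', r₂) ∈ ω ∧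
                ω ∈ openConnIn (ι '' ↑d.1 \ F.inSet (a * M ^ K)) v v'}}) ∧
      0 ≤ e ∧ e ≤ (1 - c) ^ (m / 2) * (rcMeasure G p q ∅).real (openConn (ι z) y) ∧
      (rcMeasure G p q ∅).real (openConn (ι z) y) = ∑ d : Finset Wt × Finset Wt, t d * u d + e := by
  obtain ⟨e, h0, h1, h2⟩ := F.openConn_eq_windowSum_add_junk G ι W₀ K z y hp hq hc1 ha hM hm hη hE hR
    hL hnb hcore hz hy _ _ (fun _ => rfl) (fun _ => rfl)
  exact ⟨_, _, e, fun _ => rfl, fun _ => rfl, h0, h1, h2⟩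

end ScaleFrame

end Literature.Probability.LatticeModels
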